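import Mathlib
import Summits.NavierStokesRegularity.NavierStokesRegularity.Theses.CompletionRelayChain
import Literature.Analysis.FluidPDE.Tao2016AveragedNS.RestartedCascadeFlows
import Summits.NavierStokesRegularity.NavierStokesRegularity.Theorems.CompletionRelayChainDefs
import Summits.NavierStokesRegularity.NavierStokesRegularity.Theorems.CompletionRelayChainRelayFrontStepIdle
import Summits.NavierStokesRegularity.NavierStokesRegularity.Theorems.CompletionRelayChainRelayFrontStepStubTail
import Summits.NavierStokesRegularity.NavierStokesRegularity.Theorems.CompletionRelayChainRelayFrontStepBlockApriori
import Summits.NavierStokesRegularity.NavierStokesRegularity.Theorems.CompletionRelayChainRelayFrontStepStubSlack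
import HarnessLib
import Summits.NavierStokesRegularity.NavierStokesRegularity.Theorems.CompletionRelayChainRelayFrontStepStubPhaseI
import Summits.NavierStokesRegularity.NavierStokesRegularity.Theorems.CompletionRelayChainRelayFrontStepPieces
import Summits.NavierStokesRegularity.NavierStokesRegularity.Theorems.CompletionRelayChainRelayFrontStepIgnition

/-!
LINE `window_v2` (RESHAPE of LINE `window`, skeleton 563fb2ada36a44fe; v3) for crux `RelayFrontStep` =
stmt-NavierStokesRegularity-24850 (route CompletionRelayChain → rung TL-M3-R64; MODEL lattice, no Navier–Stokes
statement, no summit). Lead prover ns-crc-p1 (g0: census D1/D2, registration, `stub_tail`; g2: `stub_wake`,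
reshape v2e); repair census `Cruxes/RelayFrontStep/REPAIR-CENSUS-crc-p1.md`.

WHAT CHANGED vs `window` (the two registered stubs of `window` were mis-stated, census D1/D2):
* the transition description is a predicate on amplitudes AND ENERGIES, `RelayWindow₃ S F`: front and next
  shell on amplitudes WITH SIGN FLOORS (D2), every other clause on ENERGIES (D1) — ahead and idle per mode,
  wake per SHELL (v3);
* the idle mode `3` (zero row) gets its own energy clause and its stub is PROVED here (`stub_idle`);
* the epoch envelope is two-piece (`relayEnv₂`);
* the checkpoint carries the ONE-SIDED ratio `a = S 0 1 τ₁ ≥ 17/20` (numerics 0.92–1.06; no upper bound is used).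
STATUS (FINAL, 2026-08-28 g3: every stub LANDED — `stub_phaseI` p636053 (computational), `stub_ignition` (`CompletionRelayChainRelayFrontStepIgnition`, ns-crc-p2),
pieces `…RelayFrontStepPieces` p636776; this file is sorry-free and closes the crux; v7 = g2; v4 + Phase I/II split; v6 = `PhaseIEndBox` numerals; v7 = `PhaseIEnvelope` added to the
Phase I → Phase II interface, nothing else changed):
* v7b (g3, 13:2xZ): the statements of `stub_phaseI` / `stub_ignition` are COMMENT-FREE (token-identical to v7; legends
  moved to the docstrings) — the gate's `--supports` stub matcher compares comment-stripped headers while `skeleton check`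
  registered the raw text (p635386 `supports.stub-mismatch` on a verbatim copy); `stub_phaseI` is PROVED (all K files landed,
  `…PhaseISoundMain.phaseI_main` p634786 + `…PhaseIShell2.shell2Bound` p633512 + `…PhaseIRunAll.cells_all` p633132) and lands
  as `Theorems/CompletionRelayChainRelayFrontStepStubPhaseI.lean` against this registration;
* RESHAPE v3 — THE WAKE CLAUSE IS ON SHELL ENERGIES (`RelayWindow₃`, `wakeS k = ½·(1/4)·2^{−k}`): an
  adversarial screen (kit j300400, exact flows) showed the per-mode wake clause of `W₂` is NOT re-entered
  (a negative wake carrier absorbs its own trigger's energy: carrier energy of old shell `−1` reaches 1.10× its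
  per-mode cap), while shell energies move only by bond fluxes; screens of `W₃` (kit j300680/j301212): worst
  shell-energy landing ratio 0.67, `a ≥ 0.957`;
* RESHAPE v4 — the wake forcing of the front block is UNCONDITIONAL and the block has an A PRIORI BOUND: along
  every flow from a `W₃`-state, old shell `−4` stays under `(1+s/20)·wakeS(−4)` and EVERY shell `k ≥ −3` keeps
  `Σᵢ F i k ≤ 5/2` on `[0, 8]` (landed `block_apriori`, `block_start_le`); so `stub_frontCert` receives both as
  plain hypotheses and no longer owes the wake-side bootstrap nor the epoch envelope on old shells `−3 … −1`;
* `stub_tail` LANDED (p604129) and its sup-free form `stub_tail_int` (p607134; critic N1's thin sup clause dropped);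
* `stub_wakeShell` PROVED here from the landed shell-energy wake lemma `wake_shell` (p609715; per-mode version p606960);
* `stub_slack` LANDED (p607940: `L`-free slack bounds on the block shells); `stub_idle` PROVED here;
* v5 (dss_57): `stub_frontCert` is PROVED here from TWO registered stubs — `stub_phaseI` (XL numeric: Taylor-model
  tables on `[0, T*]`, `T* = 147/64`, END-BOX `PhaseIEndBox` in Defs, format `…PhaseIFormat`) and `stub_ignition`
  (L analytic: END-BOX → checkpoint; ns-crc-p2); v7: Phase I also hands over `PhaseIEnvelope S` (a priori envelope of
  old shells `−1 … 2` on `[0,T*]`, Defs), which the ignition lemma needs for the old-shell-`−1` back-flow and the floors;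
  K-side of `stub_phaseI` landed so far: `…PhaseIFormat` (tables), `…PhaseITaylorModel` (K1), `…PhaseIPseudoStep`
  (K3 (iv)(v)), `…PhaseIBlockField` + `…PhaseIBlockRows` (K2 (a)(b): `relayQ`, `quadTerm_block`, block curve);
* the statement of `stub_frontCert` (v4, unchanged) = the FRONT-BLOCK CERTIFICATE: hypotheses = `W₃` start, explicit
  slack, the flow, the tail forcing (T) (conditional on `∫u₂², ∫|r₂u₂|`, = `stub_tail_int`), the wake forcing
  (W) and the a priori bound (A) (both unconditional); conclusions = checkpoint, landing clauses, near-wake shell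
  energies, envelope on old shells `0, 1, 2`, the two integrals — a finite-dimensional validated-numerics
  enclosure of 18 amplitudes over the hop (CERT-SPEC in `Cruxes/RelayFrontStep/CERT-SPEC-stub_frontCert.md`).
Composition `RelayFrontStep_of` proved from the stubs. Numerals: kit j297643/j297847 (planner), j298299 (g0),
j300243/j300400/j300680/j301212 (g2).
-/

noncomputable section
set_option linter.dupNamespace false

open Set Literature.Analysis.FluidPDE.TaoCascade

namespace Summit.NavierStokesRegularity.NavierStokesRegularity.Cruxes.RelayFrontStep.Window2

-- The objects `RelayRows`, `relayX0`, `relayEnv₂`, `aheadE`, `wakeE`, `idleE`, `RelayWindow₂`, `RelayP₂` are the tree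
-- module `Theorems/CompletionRelayChainDefs.lean` (same namespace).

/-! ### The stubs -/

-- `stub_slack` (L-FREE SLACK BOUNDS on the block shells): LANDED — `Theorems/CompletionRelayChainRelayFrontStepStubSlack.lean` (p607940).

-- `stub_phaseI` (PHASE I of the front-block certificate, XL numeric): LANDED — `Theorems/CompletionRelayChainRelayFrontStepStubPhaseI.lean`
-- (p636053; kernel-replayed self-integrating Taylor-model checker `…PhaseIChecker` on 96 grid cells + soundness chain `…PhaseISound*`,
-- `…PhaseISoundMain.phaseI_main`, `…PhaseIShell2.shell2Bound`, `…PhaseIRunAll.cells_all`). The name resolves to the tree theorem below.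

-- `stub_ignition` (PHASE II, the ignition lemma, L analytic; ns-crc-p2): LANDED — `Theorems/CompletionRelayChainRelayFrontStepIgnition.lean`.

/-- THE FRONT-BLOCK CERTIFICATE (statement of v4, PROVED from the two stubs `stub_phaseI` ∘ `stub_ignition`, v7 interface). -/
theorem stub_frontCert :
  ∀ α : Fin 4 → Fin 4 → Fin 4 → ℤ × ℤ × ℤ → ℝ, InTableClass 64 α → RelayRows α →
    ∀ (τ : ℝ) (S₀ F₀ B₀ : Fin 4 → ℤ → ℝ) (S F : Fin 4 → ℤ → ℝ → ℝ), RelayWindow₃ S₀ F₀ →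
      (∀ i k, 0 ≤ B₀ i k) →
      (∀ i, B₀ i (-3) ≤ 28 / 10 ^ 6) → (∀ i, B₀ i (-2) ≤ 14 / 10 ^ 6) → (∀ i, B₀ i (-1) ≤ 7 / 10 ^ 6) →
      (∀ i, B₀ i 0 ≤ 35 / 10 ^ 7) → (∀ i, B₀ i 1 ≤ 18 / 10 ^ 7) → (∀ i, B₀ i 2 ≤ 9 / 10 ^ 7) →
      8 ≤ τ → PseudoFlowOn τ 1 α (1 / 10 ^ 8) (1 / 10 ^ 8) S₀ F₀ B₀ S F →
      -- (T) tail forcing, for every initial window [0, t]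
      (∀ t ∈ Icc (0 : ℝ) τ, t ≤ 8 → (∫ s in (0 : ℝ)..t, S 1 2 s ^ 2) ≤ 1 / 10 ^ 11 →
        (∫ s in (0 : ℝ)..t, |S 2 2 s * S 1 2 s|) ≤ 1 / 10 ^ 13 →
          ∀ s ∈ Icc (0 : ℝ) t, ∑ i, F i 3 s ≤ 6 / 10 ^ 20) →
      -- (W) wake forcing on [0, 8] (unconditional: `block_apriori`)
      (∀ s ∈ Icc (0 : ℝ) τ, s ≤ 8 → ∑ i, F i (-4) s ≤ (1 + s / 20) * wakeS (-4)) →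
      -- (A) a priori bound on [0, 8]: every shell ≥ −3 carries at most 5/2 (unconditional: `block_apriori`)
      (∀ s ∈ Icc (0 : ℝ) τ, s ≤ 8 → ∀ k : ℤ, -3 ≤ k → ∑ i, F i k s ≤ 5 / 2) →
      ∃ τ₁ : ℝ, 0 < τ₁ ∧ τ₁ ≤ 8 ∧ 17 / 20 ≤ S 0 1 τ₁ ∧
        S 1 1 τ₁ = 4175 / 10000 * S 0 1 τ₁ ∧
        -- front and next shell after rescaling (amplitudes, with floors)
        (-(1 / 10 ^ 6) ≤ S 2 1 τ₁ / S 0 1 τ₁ ∧ S 2 1 τ₁ / S 0 1 τ₁ ≤ 12 / 10000 ∧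
          -(1 / 10 ^ 8) ≤ S 0 2 τ₁ / S 0 1 τ₁ ∧ S 0 2 τ₁ / S 0 1 τ₁ ≤ 15 / 100 ∧
          -(1 / 10 ^ 8) ≤ S 1 2 τ₁ / S 0 1 τ₁ ∧ S 1 2 τ₁ / S 0 1 τ₁ ≤ 1 / 100000 ∧
          -(1 / 10 ^ 8) ≤ S 2 2 τ₁ / S 0 1 τ₁ ∧ S 2 2 τ₁ / S 0 1 τ₁ ≤ 1 / 100000) ∧
        -- near wake (new offsets −4 … −1 = old shells −3 … 0), SHELL energies
        (∀ k : ℤ, -4 ≤ k → k ≤ -1 → (∑ i, F i (1 + k) τ₁) / S 0 1 τ₁ ^ 2 ≤ wakeS k) ∧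
        -- epoch envelope of old shells 0, 1, 2 on the hop (per mode; shells −3 … −1 are covered by (A))
        (∀ s ∈ Icc (0 : ℝ) τ₁, ∀ (i : Fin 4) (k : ℤ), 0 ≤ k → k ≤ 2 → i ≠ 3 → F i k s ≤ relayEnv₂ k) ∧
        -- old shell 2's trigger / relay, time-integrated (the tail's input)
        (∫ s in (0 : ℝ)..τ₁, S 1 2 s ^ 2) ≤ 1 / 10 ^ 11 ∧
        (∫ s in (0 : ℝ)..τ₁, |S 2 2 s * S 1 2 s|) ≤ 1 / 10 ^ 13 := by
  intro α hE hrows τ S₀ F₀ B₀ S F hW hB0 hBm3 hBm2 hBm1 hB00 hB1 hB2 hτ hflow hT hW4 hA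
  obtain ⟨hbox, hPE, hEnv, hI1, hI2⟩ :=
    stub_phaseI α hE hrows τ S₀ F₀ B₀ S F hW hB0 hBm3 hBm2 hBm1 hB00 hB1 hB2 hτ hflow hT hW4 hA
  exact stub_ignition α hE hrows τ S₀ F₀ B₀ S F hW hB0 hBm3 hBm2 hBm1 hB00 hB1 hB2 hτ hflow hT hW4 hA hbox hPE hEnv
    hI1 hI2

-- `stub_tail` (THE FAR TAIL): LANDED — `Theorems/CompletionRelayChainRelayFrontStepStubTail.lean` (p604129; sup-free
-- form `stub_tail_int`, p607134).
-- `stub_wake` (the far wake, per-mode form of v2): LANDED p606960; v3 uses the shell-energy form `stub_wakeShell` below.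

-- `stub_wakeShell`, `stub_idle`, `relayDatum_window₃` and the numeric lemmas of the robust step: LANDED —
-- `Theorems/CompletionRelayChainRelayFrontStepPieces.lean` (moved out of this skeleton verbatim, v9).

/-- The robust front step for the repaired description `W₃`, from the stubs. -/
theorem relayWindow₃_robustStep :
  ∀ α : Fin 4 → Fin 4 → Fin 4 → ℤ × ℤ × ℤ → ℝ, InTableClass 64 α → RelayRows α →
    RobustStep 1 (1 / 2) 8 (1 / 10 ^ 8) 0 α RelayP₃ relayEnv₂ := by
  intro α hE hrows L S₀ F₀ B₀ hP hB τ hτ S F hflow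
  have hτ0 : 0 < τ := by linarith
  have hW : RelayWindow₃ S₀ F₀ := hP
  obtain ⟨h00, h10, h20l, h20u, h01l, h01u, h11l, h11u, h21l, h21u, hahead, hwake, hidle⟩ := hW
  -- the forcing facts (T), (W) for every initial window, from the landed tail / wake
  have hT : ∀ t ∈ Icc (0 : ℝ) τ, t ≤ 8 → (∫ s in (0 : ℝ)..t, S 1 2 s ^ 2) ≤ 1 / 10 ^ 11 →
      (∫ s in (0 : ℝ)..t, |S 2 2 s * S 1 2 s|) ≤ 1 / 10 ^ 13 →
        ∀ s ∈ Icc (0 : ℝ) t, ∑ i, F i 3 s ≤ 6 / 10 ^ 20 :=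
    fun t ht ht8 hI1 hI2 =>
      (stub_tail_int α hE hrows τ S₀ F₀ B₀ S F hτ0 hflow hahead hidle t ht ht8 hI1 hI2).1
  obtain ⟨hBm3, hBm2, hBm1, hB0, hB1, hB2⟩ := stub_slack L B₀ hB
  -- the unconditional wake forcing (W) and the a priori bound (A)
  have hE0 := block_start_le hflow hτ0 hP hB0 hB1
  obtain ⟨hW4, hA⟩ := block_apriori hflow hτ hE hrows hE0 hwake
  obtain ⟨τ₁, hτ₁, hτ₁c, ha, hcross, ⟨g1, g2, g3, g4, g5, g6, g7, g8⟩, hnw, henvF, hI1, hI2⟩ :=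
    stub_frontCert α hE hrows τ S₀ F₀ B₀ S F hP (fun i k => (hB i k).1) hBm3 hBm2 hBm1 hB0 hB1 hB2 hτ hflow
      hT hW4 hA
  have hτ₁I : τ₁ ∈ Icc (0 : ℝ) τ := ⟨hτ₁.le, hτ₁c.trans hτ⟩
  -- the tail (old shells ≥ 3) from the time-integrated bounds
  obtain ⟨h3, htailEnv, htailLand⟩ :=
    stub_tail_int α hE hrows τ S₀ F₀ B₀ S F hτ0 hflow hahead hidle τ₁ hτ₁I hτ₁c hI1 hI2
  -- old shells −3 … −1: per-mode envelope from the a priori bound (A)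
  have hmid : ∀ s ∈ Icc (0 : ℝ) τ₁, ∀ (i : Fin 4) (k : ℤ), -3 ≤ k → k ≤ -1 → F i k s ≤ relayEnv₂ k := by
    intro s hs i k hk1 hk2
    have hsτ : s ∈ Icc (0 : ℝ) τ := ⟨hs.1, hs.2.trans (hτ₁c.trans hτ)⟩
    have h1 : F i k s ≤ ∑ j, F j k s :=
      Finset.single_le_sum (f := fun j => F j k s) (fun j _ => hflow.nonneg_F j k s hsτ) (Finset.mem_univ i)
    have h2 := hA s hsτ (hs.2.trans hτ₁c) k hk1
    exact (h1.trans h2).trans (relayEnv₂_ge_of_le_neg_one hk2)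
  -- the wake (old shells ≤ −4) from the envelope of old shell −3
  have hm3 : ∀ s ∈ Icc (0 : ℝ) τ₁, ∀ i : Fin 4, i ≠ 3 → F i (-3) s ≤ relayEnv₂ (-3) :=
    fun s hs i _ => hmid s hs i (-3) (by norm_num) (by norm_num)
  obtain ⟨hwakeEnv, hwakeLand⟩ := stub_wakeShell α hE hrows τ S₀ F₀ B₀ S F hτ0 hflow hwake τ₁ hτ₁I hτ₁c hm3
  obtain ⟨hidleEnv, hidleLand⟩ := stub_idle α hE hrows τ S₀ F₀ B₀ S F hτ0 hflow hidle
  set a : ℝ := S 0 1 τ₁ with ha_def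
  have hapos : 0 < a := by linarith
  refine ⟨τ₁, a, hτ₁, hτ₁c, hapos, rpow_neg_half_le.trans ha, le_abs_self _, ?_, ?_⟩
  · -- the rescaled level-1 state is a `W₃`-state
    show RelayWindow₃ (fun i k => S i (1 + k) τ₁ / a) (fun i k => F i (1 + k) τ₁ / a ^ 2)
    refine ⟨?_, ?_, ?_, ?_, ?_, ?_, ?_, ?_, ?_, ?_, ?_, ?_, ?_⟩
    · show S 0 (1 + 0) τ₁ / a = 1
      rw [add_zero, ha_def]; exact div_self hapos.ne'
    · show S 1 (1 + 0) τ₁ / a = 4175 / 10000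
      rw [add_zero, ha_def, hcross, mul_div_assoc, div_self hapos.ne', mul_one]
    · show -(1 / 10 ^ 6) ≤ S 2 (1 + 0) τ₁ / a
      rw [add_zero]; exact g1
    · show S 2 (1 + 0) τ₁ / a ≤ 12 / 10000
      rw [add_zero]; exact g2
    · show -(1 / 10 ^ 8) ≤ S 0 (1 + 1) τ₁ / a
      exact g3
    · exact g4
    · exact g5
    · exact g6
    · exact g7
    · exact g8
    · -- far ahead: new offset 2 from the shell-3 bound, ≥ 3 from the tail
      intro k hk i hi
      by_cases hk2 : k = 2
      · subst hk2
        show F i (1 + 2) τ₁ / a ^ 2 ≤ aheadE 2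
        have hsum : F i 3 τ₁ ≤ ∑ j, F j 3 τ₁ :=
          Finset.single_le_sum (f := fun j => F j 3 τ₁) (fun j _ => hflow.nonneg_F j 3 τ₁ hτ₁I)
            (Finset.mem_univ i)
        have h33 := h3 τ₁ ⟨hτ₁.le, le_rfl⟩
        rw [show (1 + 2 : ℤ) = 3 by norm_num, div_le_iff₀ (by positivity)]
        linarith [shell_three_reenters ha]
      · exact htailLand a ha k (by omega) i hi
    · -- wake (shell energies): new offsets −4 … −1 from the front block, ≤ −5 from the wake stub
      intro k hk
      show (∑ i, F i (1 + k) τ₁ / a ^ 2) ≤ wakeS k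
      rw [← Finset.sum_div]
      by_cases hk3 : -4 ≤ k
      · exact hnw k hk3 hk
      · exact hwakeLand a ha k (by omega)
    · intro k
      exact hidleLand τ₁ hτ₁I a ha k
  · -- energies under the epoch envelope on `[0, τ₁]`
    intro s hs i k
    show F i k s ≤ relayEnv₂ k
    by_cases hi : i = 3
    · subst hi
      exact hidleEnv s ⟨hs.1, hs.2.trans (hτ₁c.trans hτ)⟩ k
    by_cases hlo : k ≤ -4
    · exact hwakeEnv s hs i k hlo hi
    by_cases hhi : 3 ≤ k
    · exact htailEnv s hs i k hhi hi
    by_cases hmd : k ≤ -1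
    · exact hmid s hs i k (by omega) hmd
    · exact henvF s hs i k (by omega) (by omega) hi

/-- COMPOSITION: the crux `RelayFrontStep` BY NAME (θ = 1/2, c = 8, η = 1e-8, j₀ = 0, X₀ = relayX0,
P = RelayP₃ = W₃, env = relayEnv₂). -/
theorem RelayFrontStep_of :
    Summit.NavierStokesRegularity.NavierStokesRegularity.Theses.CompletionRelayChain.RelayFrontStep := by
  intro α hE hrows
  refine ⟨1 / 2, 8, 1 / 10 ^ 8, 0, relayX0, RelayP₃, relayEnv₂, by norm_num, by norm_num, by norm_num,
    by norm_num, ?_, ?_, ?_⟩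
  · simp [relayX0]
  · exact relayDatum_window₃
  · exact relayWindow₃_robustStep α hE hrows

end Summit.NavierStokesRegularity.NavierStokesRegularity.Cruxes.RelayFrontStep.Window2
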